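import Literature.AlgebraicGeometry.HodgeTheory.HyperplaneSectionLocalSystem
import Literature.AlgebraicGeometry.HodgeTheory.ClassesSupportedOnComplexification
import Literature.AlgebraicGeometry.HodgeTheory.RationalLattice
import Literature.AlgebraicGeometry.HodgeTheory.LocallyTrivialExtensionClasses

/-!
# Route LinearSystemTorelli — crux `LocalTubeSpan` (stmt-HodgeConjecture-2490): the rational monodromy is a `ℚ`-form

Helper file (`--supports stmt-HodgeConjecture-2490`, line `Sketch` of the crux chain, cycle 5, stub
`stub_ratTensorEquiv`).  The line proves cyclic detection for Schnell's third map over `ℚ`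
(`Rep ℚ G`), while the tree's hyperplane-section package is over `ℂ`: a
`D : DirectImageLocalSystem π n` carries local systems `D.V k` on the smooth-fibre locus
`U = smoothFiberLocus π n` with `D.fiberIso k s : (D.V k)_s ≃ₗ[ℂ] Hᵏ(X_s(ℂ); ℂ)` and the monodromy
representation `monodromyRepObj (D.V k) s : Rep ℂ (π₁(U, s))`.  Cycle 4 proved portability of cyclic
detection along a finite-dimensional `k`-form (`localTubeSpan_injective_evalCoinv_iff_of_tensorEquiv`,
file `…LocalTubeSpanBaseChange`: hypotheses `[FiniteDimensional k A.V]` and an intertwining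
`e : K ⊗[k] A.V ≃ₗ[K] A'.V`, `e (c ⊗ ρ(g) x) = ρ'(g) (e (c ⊗ x))`).

* `localTubeSpan_ratTensorEquiv` — for ANY `ℚ`-representation `ρ` of `π₁(U, s)` on
  `Hᵏ(X_s(ℂ); ℚ)` lifting the monodromy on the real carrier through the rational lattice map
  (`ofRatClass (ρ g x) = D.monodromyBetti k s g (ofRatClass x)`; the rational monodromy, whose
  existence is a separate stub of the line), the two hypotheses of the base-change theorem hold
  for `e := ofRatClassBaseChangeEquiv s.2 k ≫ (D.fiberIso k s)⁻¹ : ℂ ⊗_ℚ Hᵏ(X_s; ℚ) ≃ₗ[ℂ] (D.V k)_s`: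
  `Hᵏ(X_s(ℂ); ℚ)` is finite-dimensional (`finiteDimensional_bettiCohomology`, i.e. the tree's
  `finite_singularCohomology_rat_complexPoints`) and `e` intertwines `1 ⊗ ρ` with the monodromy of
  `D.V k` (`ofRatClassBaseChange_tmul`, `monodromyBetti_apply`, `transportBetti_apply`,
  `LocalSystem.monodromyRep_apply`).

Pure unfolding over the tree's API; no named facts.
-/

-- `Summit.HodgeConjecture.HodgeConjecture.Theorems` is the mandated namespace (single-conjunct summit:
-- Sub = Summit), which `linter.dupNamespace` flags on every declaration; the lakefile turns the
-- linter off tree-wide (weak option), restated here so stand-alone elaboration is warning-free too.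
set_option linter.dupNamespace false

noncomputable section

open Literature.AlgebraicGeometry Literature.AlgebraicGeometry.HodgeTheory
open Literature.AlgebraicTopology.SingularHomology
open scoped TensorProduct

namespace Summit.HodgeConjecture.HodgeConjecture.Theorems

variable {𝒳 Sb : Motives.SchemeOver ℂ} {π : 𝒳 ⟶ Sb} {n : ℕ}

/-- **The rational monodromy is a finite-dimensional `ℚ`-form of `monodromyRepObj (D.V k) s`.**
For a `ℚ`-representation `ρ` of `π₁(U, s)` on `Hᵏ(X_s(ℂ); ℚ)` with
`ofRatClass (ρ g x) = D.monodromyBetti k s g (ofRatClass x)`, the space `Hᵏ(X_s(ℂ); ℚ)` is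
finite-dimensional and `e := ofRatClassBaseChangeEquiv s.2 k ≫ (D.fiberIso k s)⁻¹` satisfies
`e (c ⊗ ρ(g) x) = (monodromy of D.V k at s)(g) (e (c ⊗ x))` — exactly the hypotheses of
`localTubeSpan_injective_evalCoinv_iff_of_tensorEquiv`. [folklore] -/
theorem localTubeSpan_ratTensorEquiv (D : DirectImageLocalSystem π n) (k : ℕ) (s : smoothFiberLocus π n)
    (ρ : Representation ℚ (FundamentalGroup (smoothFiberLocus π n) s)
      (Motives.bettiCohomology (Motives.fiberOver π s.1) k))
    (hρ : ∀ (g : FundamentalGroup (smoothFiberLocus π n) s)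
      (x : Motives.bettiCohomology (Motives.fiberOver π s.1) k),
      ofRatClass (Motives.ComplexPoints (Motives.fiberOver π s.1)) k (ρ g x) =
        D.monodromyBetti k s g (ofRatClass (Motives.ComplexPoints (Motives.fiberOver π s.1)) k x)) :
    FiniteDimensional ℚ (Motives.bettiCohomology (Motives.fiberOver π s.1) k) ∧
      ∀ (g : FundamentalGroup (smoothFiberLocus π n) s) (c : ℂ)
        (x : Motives.bettiCohomology (Motives.fiberOver π s.1) k),
        ((ofRatClassBaseChangeEquiv s.2 k).trans (D.fiberIso k s).symm) (c ⊗ₜ[ℚ] ρ g x) =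
          (monodromyRepObj (D.V k) s).ρ g
            (((ofRatClassBaseChangeEquiv s.2 k).trans (D.fiberIso k s).symm) (c ⊗ₜ[ℚ] x)) := by
  refine ⟨finiteDimensional_bettiCohomology s.2 k, fun g c x => ?_⟩
  rw [LinearEquiv.trans_apply, LinearEquiv.trans_apply, ofRatClassBaseChangeEquiv_apply,
    ofRatClassBaseChangeEquiv_apply, Motives.ofRatClassBaseChange_tmul,
    Motives.ofRatClassBaseChange_tmul, hρ, D.monodromyBetti_apply, D.transportBetti_apply,
    map_smul, map_smul, LinearEquiv.symm_apply_apply, Rep.of_ρ,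
    Motives.LocalSystem.monodromyRep_apply, map_smul]

end Summit.HodgeConjecture.HodgeConjecture.Theorems

end
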